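import Summits.AnomalousDissipation.AnomalousDissipation.Theorems.PumpSignGateTameSignedMirrorLimitTGWeakLimits


/-!
# Route PumpSignGate — support `TameSignedMirrorLimitTG` (stmt-AnomalousDissipation-27674), proved

T_sign «TAME SIGNED MIRROR LIMIT» (binder `hT` of the route's deciding theorem `closes`; the Rellich
passage carrying the three pump-sign clauses).  At the pinned Taylor–Green force `f_TG`: if
`u_n ∈ V ∩ Fix K` are steady weak solutions of `NS_{ν_n}(f_TG)` (`ν_n > 0`, `ν_n → 0`) of spectral
enstrophy `eGradNormSq u_n ≤ M`, each admitting honest `L²` weak gradients `g_n = (∂_j u_n)_j` whose curl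
components are PUMP-SIGNED on the three wedge families `W_z, W_y, W_x(θ₀, η)` (a.e. sign conditions
`ω_z s_z ≥ 0`, `ω_y s_y ≥ 0`, `ω_x s_x ≥ 0` there), then some `v ∈ V ∩ Fix K` with honest `L²` weak
gradients satisfying the SAME three a.e. sign conditions is a steady weak Euler state of `f_TG`.

Proof (Temam 1979 Ch. II §1 (iii); FMRT 2001 Ch. II §§6–7; Evans 2010 §5.2.1, §D.4).
1. RELLICH.  The enstrophy ball is norm-compact in `H` (`Torus.isCompact_setOf_eGradNormSq_le`): a
   subsequence `u_{ψ n} → v` in `H`, `v ∈ V` (finite enstrophy), `v ∈ Fix K` (the a.e. mirror class is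
   closed, `isClosed_mirrorClassK`), and `v` is a steady weak Euler state (split
   `⟨F_0(u), w⟩ = ⟨F_ν(u), w⟩ − ν (u, Δw)`, `Torus.continuous_nsGeneratorPairing`,
   `Torus.continuous_pairing_coe`) — verbatim the passage of the sibling closer of
   `SteadyMirrorGate.TameMirrorLimitTG`, with the subsequence exposed.
2. WEAK GRADIENTS ARE BOUNDED.  `∫ ‖g_n^j‖² ≤ eGradNormSq u_n ≤ M` because the `L²` mass of an honest
   weak gradient IS the spectral dissipation (`Torus.eGradNormSq_eq_lintegral_of_hasWeakPartialDeriv`).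
3. WEAK COMPACTNESS.  A further subsequence `g_{ψκ n}^j ⇀ G^j` weakly in `L²(T³; ℝ³)` for `j = 0, 1, 2`
   simultaneously (diagonal extraction against a countable dense family and the Riesz representation:
   `exists_strictMono_forall_tendsto_real`, `exists_mem_tendsto_inner_of_subset_closure_span` of
   `DiagonalWeakLimits`).
4. `G^j` IS A WEAK GRADIENT OF `v`.  Test the weak identity `∫ ∂_jφ • u_n = −∫ φ • g_n^j` coordinatewise
   against `φ e_i`: the left side is an `L²` pairing of `u_n` (norm-continuous), the right side an
   `L²` pairing of `g_n^j` (weakly continuous).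
5. SIGNS PASS TO WEAK LIMITS.  For a measurable `B ⊆ W`, `∫_B ω s = ⟪G^i, 1_B s e_a⟫ − ⟪G^k, 1_B s e_b⟫`
   is the limit of the same pairings of `g_n`, which are `∫_B ω_n s ≥ 0`; hence `1_W ω s ≥ 0` a.e.
   (`ae_nonneg_of_forall_setIntegral_nonneg`).
The pinning hypothesis `f = f_TG` and `ν_n > 0`, `θ₀, η > 0` are not used.

References: Temam 1979, Ch. II §1 Thm 1.2 (iii) [Temam1979]; Foias–Manley–Rosa–Temam 2001, Ch. II
§§6–7 [FMRTTurbulence2001]; Evans 2010, §5.2.1, App. D.4 [Evans2010]; Ożański–Pooley 2018, proof of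
Thm 6.37 Steps 1, 3 [OzanskiPooley2018].  (decomp-ad cell, lens-6 g57.)

TREE LANDING NOTE (decomp-ad census g17, prover-role seat): the lens-6 g57 landable K3 (sha256 e87805263d17f7c8…, 565 l.) was
BOUNCED by the gate lint `statement-form` («Theorems files with proofs are ≤ 400 lines») and is landed SPLIT BY TOPIC into three modules,
every declaration byte-identical: `PumpSignGateTameSignedMirrorLimitTGRellich` (§1–§2: closed mirror class, Rellich passage, `Lp`
bookkeeping), `PumpSignGateTameSignedMirrorLimitTGWeakLimits` (§3–§5: weak compactness, weak gradients, a.e. signs; imports the first) and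
this closer (imports the second).
-/

-- `Summit.<Summit>.<Problem>` is the tree's mandated summit-side namespace (CONVENTIONS §2); single-conjunct summit, duplicate deliberate.
set_option linter.dupNamespace false

noncomputable section

namespace Summit.AnomalousDissipation.AnomalousDissipation.Theorems

open MeasureTheory Filter Topology
open scoped InnerProductSpace ENNReal
open Literature.Analysis.FunctionSpaces Literature.Analysis.FluidPDE
open Literature.Analysis.FunctionSpaces.Torus Literature.Analysis.FluidPDE.Torus
open Summit.AnomalousDissipation.AnomalousDissipation.Theses.PumpSignGate
open PumpSignGateTame

/-- **Route decl `PumpSignGate.TameSignedMirrorLimitTG` (stmt-AnomalousDissipation-27674), proved** —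
the Rellich passage at the pinned Taylor–Green force inside `Fix K`, carrying honest weak gradients
(weak `L²` compactness) and the three a.e. pump-sign clauses (weakly closed). [folklore] -/
theorem pumpSignGate_tameSignedMirrorLimitTG_holds : TameSignedMirrorLimitTG := by
  intro f _hf θ₀ η M ν u _hθ₀ _hη _hν hνlim hu
  -- the weak-gradient witnesses and their sign clauses
  choose g hg using fun n => (hu n).2.2.2.2
  -- Step 1: Rellich inside the closed mirror class
  obtain ⟨v, ψ, hψ, hlim, hV, hK, hsol⟩ := exists_subseq_steadyWeakEuler_of_enstrophy_le f
    {w : energySpace (Fin 3) | ∀ i j : Fin 3,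
      (fun x => ((w : Lp (EuclideanSpace ℝ (Fin 3)) 2 (volume : Measure (UnitAddTorus (Fin 3)))) : UnitAddTorus (Fin 3) → EuclideanSpace ℝ (Fin 3))
        (Function.update x i (-x i)) j) =ᵐ[volume]
      (fun x => if j = i then -(((w : Lp (EuclideanSpace ℝ (Fin 3)) 2 (volume : Measure (UnitAddTorus (Fin 3)))) : UnitAddTorus (Fin 3) → EuclideanSpace ℝ (Fin 3)) x j)
        else ((w : Lp (EuclideanSpace ℝ (Fin 3)) 2 (volume : Measure (UnitAddTorus (Fin 3)))) : UnitAddTorus (Fin 3) → EuclideanSpace ℝ (Fin 3)) x j)}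
    isClosed_mirrorClassK M ν u hνlim (fun n => (hu n).2.1)
    (fun n => (hu n).2.2.1) (fun n => (hu n).2.2.2.1)
  -- Step 2: the witnesses are bounded in `L²`
  set M' : ℝ := max M 0 with hM'
  have hM'0 : 0 ≤ M' := le_max_right _ _
  have hmem : ∀ n j, MemLp (g n j) 2 (volume : Measure (UnitAddTorus (Fin 3))) := fun n j => ((hg n).1 j).1
  have hwd : ∀ n j, HasWeakPartialDeriv j
      (((u n : Lp (EuclideanSpace ℝ (Fin 3)) 2 (volume : Measure (UnitAddTorus (Fin 3)))) : UnitAddTorus (Fin 3) → EuclideanSpace ℝ (Fin 3)))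
      (g n j) := fun n j => ((hg n).1 j).2
  set V : ℕ → Fin 3 → Lp (EuclideanSpace ℝ (Fin 3)) 2 (volume : Measure (UnitAddTorus (Fin 3))) :=
    fun n j => (hmem (ψ n) j).toLp (g (ψ n) j) with hVdef
  have hR : ∀ n j, ‖V n j‖ ≤ Real.sqrt M' := fun n j => by
    have hsq : ‖V n j‖ ^ 2 ≤ M' :=
      sq_norm_toLp_le (hmem (ψ n) j) hM'0
        ((lintegral_enorm_sq_le_eGradNormSq (Lp.memLp _) (hmem (ψ n)) (hwd (ψ n)) j).trans
          ((hu (ψ n)).2.2.2.1.trans (ENNReal.ofReal_le_ofReal (le_max_left _ _))))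
    rw [← Real.sqrt_sq (norm_nonneg (V n j))]
    exact Real.sqrt_le_sqrt hsq
  -- Step 3: weak compactness along a further subsequence
  obtain ⟨κ, G, hκ, hG⟩ := exists_subseq_weakLimit_fin V hR
  -- Step 4: `G j` is an honest weak gradient of `v`
  have hlim' : Tendsto (fun n => ((u (ψ (κ n)) : Lp (EuclideanSpace ℝ (Fin 3)) 2 (volume : Measure (UnitAddTorus (Fin 3)))))) atTop
      (𝓝 (v : Lp (EuclideanSpace ℝ (Fin 3)) 2 (volume : Measure (UnitAddTorus (Fin 3))))) :=
    (continuous_subtype_val.tendsto v).comp (hlim.comp hκ.tendsto_atTop)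
  have hGwd : ∀ j, HasWeakPartialDeriv j
      ((v : Lp (EuclideanSpace ℝ (Fin 3)) 2 (volume : Measure (UnitAddTorus (Fin 3)))) : UnitAddTorus (Fin 3) → EuclideanSpace ℝ (Fin 3))
      ((G j : Lp (EuclideanSpace ℝ (Fin 3)) 2 (volume : Measure (UnitAddTorus (Fin 3)))) : UnitAddTorus (Fin 3) → EuclideanSpace ℝ (Fin 3)) :=
    fun j => hasWeakPartialDeriv_of_weakLimit hlim' (fun n => hmem (ψ (κ n)) j) (fun n => hwd (ψ (κ n)) j)
      (fun z => hG j z)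
  -- Step 5: the three sign clauses pass to the weak limits
  have hVae : ∀ n j, ((V (κ n) j : Lp (EuclideanSpace ℝ (Fin 3)) 2 (volume : Measure (UnitAddTorus (Fin 3)))) : UnitAddTorus (Fin 3) → EuclideanSpace ℝ (Fin 3))
      =ᵐ[volume] g (ψ (κ n)) j := fun n j => (hmem (ψ (κ n)) j).coeFn_toLp
  have hWz : MeasurableSet {x : UnitAddTorus (Fin 3) |
      (min ‖x 2‖ ‖x 2 - ((1 / 2 : ℝ) : UnitAddCircle)‖ < θ₀ * min ‖x 1‖ ‖x 1 - ((1 / 2 : ℝ) : UnitAddCircle)‖ ∧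
        min ‖x 1‖ ‖x 1 - ((1 / 2 : ℝ) : UnitAddCircle)‖ < η) ∨
      (min ‖x 2‖ ‖x 2 - ((1 / 2 : ℝ) : UnitAddCircle)‖ < θ₀ * min ‖x 0‖ ‖x 0 - ((1 / 2 : ℝ) : UnitAddCircle)‖ ∧
        min ‖x 0‖ ‖x 0 - ((1 / 2 : ℝ) : UnitAddCircle)‖ < η)} :=
    (((isOpen_lt (continuous_minDist 2) (continuous_const.mul (continuous_minDist 1))).inter
      (isOpen_lt (continuous_minDist 1) continuous_const)).union
      ((isOpen_lt (continuous_minDist 2) (continuous_const.mul (continuous_minDist 0))).inter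
      (isOpen_lt (continuous_minDist 0) continuous_const))).measurableSet
  have hWy : MeasurableSet {x : UnitAddTorus (Fin 3) |
      min ‖x 1‖ ‖x 1 - ((1 / 2 : ℝ) : UnitAddCircle)‖ < θ₀ * min ‖x 2‖ ‖x 2 - ((1 / 2 : ℝ) : UnitAddCircle)‖ ∧
        min ‖x 2‖ ‖x 2 - ((1 / 2 : ℝ) : UnitAddCircle)‖ < η} :=
    ((isOpen_lt (continuous_minDist 1) (continuous_const.mul (continuous_minDist 2))).inter
      (isOpen_lt (continuous_minDist 2) continuous_const)).measurableSet
  have hWx : MeasurableSet {x : UnitAddTorus (Fin 3) |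
      min ‖x 0‖ ‖x 0 - ((1 / 2 : ℝ) : UnitAddCircle)‖ < θ₀ * min ‖x 2‖ ‖x 2 - ((1 / 2 : ℝ) : UnitAddCircle)‖ ∧
        min ‖x 2‖ ‖x 2 - ((1 / 2 : ℝ) : UnitAddCircle)‖ < η} :=
    ((isOpen_lt (continuous_minDist 0) (continuous_const.mul (continuous_minDist 2))).inter
      (isOpen_lt (continuous_minDist 2) continuous_const)).measurableSet
  have hsz : Continuous fun x : UnitAddTorus (Fin 3) =>
      ((fourier 1 (x 0) : ℂ)).im * ((fourier 1 (x 1) : ℂ)).im * ((fourier 1 (x 2) : ℂ)).re :=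
    ((continuous_fourier_im 0).mul (continuous_fourier_im 1)).mul (continuous_fourier_re 2)
  have hsy : Continuous fun x : UnitAddTorus (Fin 3) =>
      -(((fourier 1 (x 0) : ℂ)).im * ((fourier 1 (x 1) : ℂ)).re * ((fourier 1 (x 2) : ℂ)).im) :=
    (((continuous_fourier_im 0).mul (continuous_fourier_re 1)).mul (continuous_fourier_im 2)).neg
  have hsx : Continuous fun x : UnitAddTorus (Fin 3) =>
      -(((fourier 1 (x 0) : ℂ)).re * ((fourier 1 (x 1) : ℂ)).im * ((fourier 1 (x 2) : ℂ)).im) :=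
    (((continuous_fourier_re 0).mul (continuous_fourier_im 1)).mul (continuous_fourier_im 2)).neg
  have hZ := ae_sign_of_weakLimit hWz hsz 1 0 (V := fun n => V (κ n) 0) (V' := fun n => V (κ n) 1)
    (hG 0) (hG 1) (fun n => ae_sign_congr (hVae n 0) (hVae n 1) ((hg (ψ (κ n))).2.1))
  have hY := ae_sign_of_weakLimit hWy hsy 0 2 (V := fun n => V (κ n) 2) (V' := fun n => V (κ n) 0)
    (hG 2) (hG 0) (fun n => ae_sign_congr (hVae n 2) (hVae n 0) ((hg (ψ (κ n))).2.2.1))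
  have hX := ae_sign_of_weakLimit hWx hsx 2 1 (V := fun n => V (κ n) 1) (V' := fun n => V (κ n) 2)
    (hG 1) (hG 2) (fun n => ae_sign_congr (hVae n 1) (hVae n 2) ((hg (ψ (κ n))).2.2.2))
  -- Step 6: assemble
  exact ⟨v, hV, hK, ⟨fun j => ((G j : Lp (EuclideanSpace ℝ (Fin 3)) 2 (volume : Measure (UnitAddTorus (Fin 3)))) : UnitAddTorus (Fin 3) → EuclideanSpace ℝ (Fin 3)),
    fun j => ⟨Lp.memLp (G j), hGwd j⟩, hZ, hY, hX⟩, hsol⟩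

end Summit.AnomalousDissipation.AnomalousDissipation.Theorems

end
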